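import Literature.Geometry.Lorentzian.HypersurfaceNaturality
import Literature.Geometry.Lorentzian.HypersurfaceRestriction
import Literature.Geometry.Lorentzian.IsometryProofs
import Literature.Geometry.Lorentzian.ChartCalculus
import Literature.Geometry.Lorentzian.KerrConvergence
import Literature.Geometry.Lorentzian.MinkowskiGlobalHyperbolicity

/-!
# Transport of chart geodesics for `stub_flatZoneSojourn`
(helper for line `sojourn-needs-only-one-over-delta` of crux `StarvedNecks.HonestFixedRadiusSettling`,
item stmt-FinalStateConjecture-13550)

Two pieces of plumbing between a spacetime `(M, g)` and a chart `Φ : U → M`, `U : Opens E4`: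

* `isGeodesicOn_comp_of_comap` — **local isometries push geodesics forward**: for a smooth
  equidimensional immersion `Φ : N → M` and a smooth metric `g` on `M`, a geodesic `ζ` of the
  pulled-back metric `Φ^* g` (`PseudoRiemannianMetric.comap`) on an open parameter set is mapped to
  a geodesic `Φ ∘ ζ` of `g`, with velocity `dΦ(ζ')` (naturality of the induced covariant derivative
  along curves, `mfderiv_covariantDerivAlong_comap`, O'Neill 1983, Ch. 3, Prop. 3.59);
* for a late-time chart map `Φ : U → 𝓢.carrier` of a spacetime (`KerrConvergence.lean`): the
  metric components `G = η + e` of `Φ^* g`, `e = deviationExtend`, are smooth on `U`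
  (`contDiffAt_components`, via `contMDiff_pullbackBilin_holds` and the identity trivialisation of
  the bilinear-form bundle of `U`), the slab-wise `C¹` deviation `deviationCk … 1 τ ≤ δ` bounds
  `‖e(x)‖` and `‖De(x)‖` at every point of the slab (`deviation_bounds`), and `dΦ_x` is injective
  wherever `‖e(x)‖ < 1` (`injective_mfderiv_of_norm_deviation_lt`, registered form
  `flatChart_mfderiv_injective`);
* the pointwise chart algebra behind the last item and behind the Christoffel/null-cone inputs of
  the coordinate lever `cone_confinement`: for `η + e` with `‖e‖` small, the time reflection
  `θ v = (-v⁰, v⃗)` gives `(1 - ‖e‖)‖v‖² ≤ (η + e)(v, θ v)` (`norm_sq_le_bilin_add_timeReflect`,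
  nondegeneracy `eq_zero_of_forall_bilin_add_eq_zero`), null vectors satisfy `‖v‖² ≤ 3 (v⁰)²` for
  `‖e‖ ≤ 1/3` (`null_cone_estimate`), and the Christoffel map of `ChartCalculus` obeys
  `‖Γ(X, Y)‖ ≤ 3 δ ‖X‖ ‖Y‖` where `‖G - η‖ ≤ δ ≤ 1/3`, `‖DG‖ ≤ δ` (`norm_christoffel_le`).
-/

noncomputable section

set_option linter.dupNamespace false
-- instance search through the nested operator types `E4 →L[ℝ] E4 →L[ℝ] E4 →L[ℝ] ℝ`
-- (derivatives of metric components), as in `CoordCurvature.lean`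
set_option maxSynthPendingDepth 3

open Literature.Geometry.Lorentzian
open scoped Manifold ContDiff Topology
open Filter Set Topology Bundle

namespace Summit.FinalStateConjecture.FinalStateConjecture.Theorems.StarvedNecks.OneOverDelta

/-! ### Local isometries push geodesics forward -/

section Transport

variable {E : Type*} [NormedAddCommGroup E] [NormedSpace ℝ E] {H : Type*} [TopologicalSpace H]
  {I : ModelWithCorners ℝ E H} {M : Type*} [TopologicalSpace M] [ChartedSpace H M]
  [IsManifold I ∞ M]
  {E' : Type*} [NormedAddCommGroup E'] [NormedSpace ℝ E'] {H' : Type*} [TopologicalSpace H']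
  {I' : ModelWithCorners ℝ E' H'} {N : Type*} [TopologicalSpace N] [ChartedSpace H' N]
  [IsManifold I' ∞ N]
  [FiniteDimensional ℝ E] [FiniteDimensional ℝ E'] [CompleteSpace E']

/-- **Local isometries push geodesics forward** (O'Neill 1983, Ch. 3, Prop. 3.59 with Prop. 3.18).
For a smooth equidimensional immersion `Φ : N → M`, a smooth metric `g` on `M` and a geodesic `ζ`
of the pulled-back metric `Φ^* g` on an OPEN parameter set `D`, the curve `Φ ∘ ζ` is a geodesic of
`g` on `D` with velocity `dΦ(ζ')`: its tangent lift is `TΦ ∘ (tangent lift of ζ)` near each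
parameter of `D`, and `D^g(Φ ∘ ζ)'/dt = dΦ (D^{Φ^*g} ζ'/dt) = 0` (`mfderiv_covariantDerivAlong_comap`). -/
theorem isGeodesicOn_comp_of_comap
    (g : PseudoRiemannianMetric I ∞ E (TangentSpace I : M → Type _)) [g.HasLeviCivita]
    {Φ : N → M} (hpb : PseudoRiemannianMetric.contMDiff_pullbackBilin I M I' N ∞)
    (hΦ : ContMDiff I' I (∞ + 1) Φ) (hΦ' : ∀ u, Function.Injective (mfderiv I' I Φ u))
    (hdim : Module.finrank ℝ E' = Module.finrank ℝ E)
    [(g.comap hpb Φ hΦ hΦ' hdim).HasLeviCivita]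
    {ζ : ℝ → N} {D : Set ℝ} (hD : IsOpen D)
    (hζ : IsGeodesicOn (g.comap hpb Φ hΦ hΦ' hdim).leviCivita ζ D) :
    IsGeodesicOn g.leviCivita (Φ ∘ ζ) D ∧
      ∀ t ∈ D, velocity I (Φ ∘ ζ) t = mfderiv I' I Φ (ζ t) (velocity I' ζ t) := by
  have hΦs : ContMDiff I' I ∞ Φ := hΦ.of_le le_self_add
  have hζd : ∀ t ∈ D, MDifferentiableAt 𝓘(ℝ, ℝ) I' ζ t := fun t ht ↦
    IsGeodesicOn.mdifferentiableAt_holds hζ ht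
  have hvel : ∀ t ∈ D, velocity I (Φ ∘ ζ) t = mfderiv I' I Φ (ζ t) (velocity I' ζ t) := by
    intro t ht
    simp only [velocity]
    rw [mfderiv_comp t ((hΦs _).mdifferentiableAt (by simp)) (hζd t ht)]
    rfl
  have hlift : ∀ t ∈ D, tangentLift I (Φ ∘ ζ) t = tangentMap I' I Φ (tangentLift I' ζ t) := by
    intro t ht
    exact TotalSpace.ext rfl (heq_of_eq (hvel t ht))
  have hev : ∀ t ∈ D, tangentLift I (Φ ∘ ζ) =ᶠ[𝓝 t] (tangentMap I' I Φ ∘ tangentLift I' ζ) :=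
    fun t ht ↦ Filter.eventuallyEq_of_mem (hD.mem_nhds ht) fun t' ht' ↦ hlift t' ht'
  refine ⟨⟨fun t ht ↦ ?_, fun t ht ↦ ?_⟩, hvel⟩
  · have htm : ContMDiff I'.tangent I.tangent ∞ (tangentMap I' I Φ) :=
      hΦ.contMDiff_tangentMap le_rfl
    exact (((htm _).mdifferentiableAt (by simp)).comp t (hζ.1 t ht)).congr_of_eventuallyEq
      (hev t ht)
  · have key := g.mfderiv_covariantDerivAlong_comap hpb hΦ hΦ' hdim (γ := ζ)
      (W := fun t ↦ velocity I' ζ t) (t₀ := t) (hζ.1 t ht)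
    rw [hζ.2 t ht, map_zero] at key
    rw [covariantDerivAlong_congr_of_eventuallyEq g.leviCivita (γ := Φ ∘ ζ)
      (W := fun t ↦ mfderiv I' I Φ (ζ t) (velocity I' ζ t)) (hev t ht)]
    exact key.symm

end Transport

/-! ### Chart algebra: components `η + e` with small `e` -/

/-- `∑ᵢ vⁱ⁺¹ vⁱ⁺¹ = ‖v⃗‖²` (the spatial sum in `Minkowski.bilin_apply`). -/
theorem sum_succ_mul_self_eq (v : E4) : ∑ i : Fin 3, v i.succ * v i.succ = ‖E4.spatial v‖ ^ 2 := by
  rw [EuclideanSpace.real_norm_sq_eq]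
  simp [pow_two]

/-- The time reflection `θ v = (-v⁰, v⃗)`: `η(v, θ v) = ‖v‖²` and `‖θ v‖ = ‖v‖`. -/
theorem bilin_timeReflect (v : E4) :
    Minkowski.bilin v (E4.ofTimeSpace (-v 0) (E4.spatial v)) = ‖v‖ ^ 2 ∧
    ‖E4.ofTimeSpace (-v 0) (E4.spatial v)‖ = ‖v‖ := by
  constructor
  · rw [Minkowski.bilin_apply, Minkowski.norm_sq_eq_time_sq_add_norm_spatial_sq,
      ← sum_succ_mul_self_eq]
    simp only [E4.ofTimeSpace_apply_zero, E4.ofTimeSpace_apply_succ, E4.spatial_apply]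
    ring
  · have h1 := Minkowski.norm_sq_eq_time_sq_add_norm_spatial_sq
      (E4.ofTimeSpace (-v 0) (E4.spatial v))
    have h2 := Minkowski.norm_sq_eq_time_sq_add_norm_spatial_sq v
    simp only [E4.ofTimeSpace_apply_zero, E4.spatial_ofTimeSpace, neg_sq] at h1
    exact (sq_eq_sq₀ (norm_nonneg _) (norm_nonneg _)).1 (h1.trans h2.symm)

/-- `(1 - ‖e‖) ‖v‖² ≤ (η + e)(v, θ v)`: the perturbed form dominates the Euclidean norm against the
time reflection. -/
theorem norm_sq_le_bilin_add_timeReflect (e : E4 →L[ℝ] E4 →L[ℝ] ℝ) (v : E4) :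
    (1 - ‖e‖) * ‖v‖ ^ 2 ≤ Minkowski.bilin v (E4.ofTimeSpace (-v 0) (E4.spatial v)) +
      e v (E4.ofTimeSpace (-v 0) (E4.spatial v)) := by
  obtain ⟨h1, h2⟩ := bilin_timeReflect v
  have h3 : |e v (E4.ofTimeSpace (-v 0) (E4.spatial v))| ≤
      ‖e‖ * ‖v‖ * ‖E4.ofTimeSpace (-v 0) (E4.spatial v)‖ := by
    rw [← Real.norm_eq_abs]; exact e.le_opNorm₂ v _
  rw [h2] at h3
  rw [h1]
  have := (abs_le.1 h3).1
  nlinarith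

/-- **Nondegeneracy of `η + e` for `‖e‖ < 1`**: if `(η + e)(v, ·) = 0` then `v = 0`. -/
theorem eq_zero_of_forall_bilin_add_eq_zero {e : E4 →L[ℝ] E4 →L[ℝ] ℝ} (he : ‖e‖ < 1) {v : E4}
    (hv : ∀ w, Minkowski.bilin v w + e v w = 0) : v = 0 := by
  have h := norm_sq_le_bilin_add_timeReflect e v
  rw [hv] at h
  have h2 : ‖v‖ ^ 2 ≤ 0 := by
    by_contra h3
    have h4 : 0 < ‖v‖ ^ 2 := lt_of_not_ge h3
    have : 0 < (1 - ‖e‖) * ‖v‖ ^ 2 := mul_pos (by linarith) h4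
    linarith
  have h3 : ‖v‖ = 0 := by nlinarith [norm_nonneg v]
  exact norm_eq_zero.1 h3

/-- **Null-cone estimate**: a null vector `v` of `η + e` with `‖e‖ ≤ δ ≤ 1/3` satisfies
`‖v‖² ≤ 3 (v⁰)²` (from `-(v⁰)² + ‖v⃗‖² = -e(v, v)`, `|e(v, v)| ≤ δ ‖v‖²`: `‖v⃗‖² ≤ 2 (v⁰)²`). -/
theorem null_cone_estimate {e : E4 →L[ℝ] E4 →L[ℝ] ℝ} {δ : ℝ} (hδ : δ ≤ 1 / 3) (he : ‖e‖ ≤ δ)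
    {v : E4} (hv : Minkowski.bilin v v + e v v = 0) : ‖v‖ ^ 2 ≤ 3 * v 0 ^ 2 := by
  have h1 : Minkowski.bilin v v = -(v 0 * v 0) + ‖E4.spatial v‖ ^ 2 := by
    rw [Minkowski.bilin_apply, sum_succ_mul_self_eq]
  have h2 : |e v v| ≤ ‖e‖ * ‖v‖ * ‖v‖ := by rw [← Real.norm_eq_abs]; exact e.le_opNorm₂ v v
  have h3 := Minkowski.norm_sq_eq_time_sq_add_norm_spatial_sq v
  have h4 : |e v v| ≤ δ * ‖v‖ ^ 2 := by
    rw [pow_two, ← mul_assoc]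
    exact h2.trans (mul_le_mul_of_nonneg_right (mul_le_mul_of_nonneg_right he (norm_nonneg v))
      (norm_nonneg v))
  have h5 : ‖E4.spatial v‖ ^ 2 - v 0 ^ 2 ≤ δ * (v 0 ^ 2 + ‖E4.spatial v‖ ^ 2) := by
    have := (abs_le.1 h4).1
    rw [h3] at this
    nlinarith [hv, h1]
  have h7 : ‖E4.spatial v‖ ^ 2 ≤ 2 * v 0 ^ 2 := by
    nlinarith [mul_nonneg (show (0:ℝ) ≤ 1 / 3 - δ by linarith) (sq_nonneg ‖E4.spatial v‖),
      mul_nonneg (show (0:ℝ) ≤ 1 / 3 - δ by linarith) (sq_nonneg (v 0))]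
  rw [h3]
  linarith

/-- `|DG(x)(A)(B)(C)| ≤ ‖DG(x)‖ ‖A‖ ‖B‖ ‖C‖` (three operator-norm estimates). -/
theorem abs_fderiv_apply₃_le {G : E4 → E4 →L[ℝ] E4 →L[ℝ] ℝ} {x : E4} {δ : ℝ}
    (hde : ‖fderiv ℝ G x‖ ≤ δ) (A B C : E4) :
    |fderiv ℝ G x A B C| ≤ δ * ‖A‖ * ‖B‖ * ‖C‖ := by
  rw [← Real.norm_eq_abs]
  calc ‖fderiv ℝ G x A B C‖ ≤ ‖fderiv ℝ G x A B‖ * ‖C‖ := ContinuousLinearMap.le_opNorm _ _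
    _ ≤ ‖fderiv ℝ G x A‖ * ‖B‖ * ‖C‖ := by
      gcongr; exact ContinuousLinearMap.le_opNorm _ _
    _ ≤ ‖fderiv ℝ G x‖ * ‖A‖ * ‖B‖ * ‖C‖ := by
      gcongr; exact ContinuousLinearMap.le_opNorm _ _
    _ ≤ δ * ‖A‖ * ‖B‖ * ‖C‖ := by gcongr

variable {U : TopologicalSpace.Opens E4}

/-- **Christoffel bound in a nearly flat chart.** For a metric `h` on `U : Opens E4` with
components `G` (`h.val x = G x`), at a point with `‖G(x) - η‖ ≤ δ ≤ 1/3` and `‖DG(x)‖ ≤ δ` the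
Christoffel map satisfies `‖Γ_x(X, Y)‖ ≤ 3 δ ‖X‖ ‖Y‖`: the Koszul form is bounded by
`3 δ ‖X‖ ‖Y‖ ‖Z‖` and `2 G(Γ, θ Γ) ≥ 2 (1 - δ) ‖Γ‖²` for the time reflection `θ`. -/
theorem norm_christoffel_le {n : ℕ∞ω}
    (h : PseudoRiemannianMetric 𝓘(ℝ, E4) n E4 (TangentSpace 𝓘(ℝ, E4) : U → Type _))
    (G : E4 → E4 →L[ℝ] E4 →L[ℝ] ℝ) (hG : ∀ x : U, h.val x = G x) {x : U} {δ : ℝ}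
    (hδ : δ ≤ 1 / 3) (he : ‖G x - Minkowski.bilin‖ ≤ δ) (hde : ‖fderiv ℝ G x‖ ≤ δ) (X Y : E4) :
    ‖OpensChart.christoffel h G x Y X‖ ≤ 3 * δ * ‖X‖ * ‖Y‖ := by
  set Γ : E4 := OpensChart.christoffel h G x Y X with hΓ_def
  set Z : E4 := E4.ofTimeSpace (-Γ 0) (E4.spatial Γ) with hZ_def
  have hδ0 : 0 ≤ δ := (norm_nonneg _).trans he
  have hZn : ‖Z‖ = ‖Γ‖ := (bilin_timeReflect Γ).2
  -- the Koszul form is `O(δ)`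
  have hK : |OpensChart.koszulForm G x Y X Z| ≤ 3 * δ * ‖X‖ * ‖Y‖ * ‖Γ‖ := by
    rw [OpensChart.koszulForm_apply]
    have h1 := abs_fderiv_apply₃_le hde X Y Z
    have h2 := abs_fderiv_apply₃_le hde Y Z X
    have h3 := abs_fderiv_apply₃_le hde Z X Y
    rw [hZn] at h1 h2 h3
    calc |fderiv ℝ G x X Y Z + fderiv ℝ G x Y Z X - fderiv ℝ G x Z X Y|
        ≤ |fderiv ℝ G x X Y Z| + |fderiv ℝ G x Y Z X| + |fderiv ℝ G x Z X Y| := by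
          refine (abs_sub _ _).trans ?_
          gcongr
          exact abs_add_le _ _
      _ ≤ 3 * δ * ‖X‖ * ‖Y‖ * ‖Γ‖ := by nlinarith
  -- `2 G(Γ, Z) = K(Y, X, Z)` and the lower bound against the time reflection
  have h2G : 2 * G x Γ Z = OpensChart.koszulForm G x Y X Z := by
    rw [← hG]; exact OpensChart.two_mul_val_christoffel (g := h) (G := G) x Y X Z
  have hlow : (1 - δ) * ‖Γ‖ ^ 2 ≤ G x Γ Z := by
    have h1 := norm_sq_le_bilin_add_timeReflect (G x - Minkowski.bilin) Γ
    have h2 : Minkowski.bilin Γ Z + (G x - Minkowski.bilin) Γ Z = G x Γ Z := by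
      simp only [sub_apply]; ring
    rw [← hZ_def, h2] at h1
    nlinarith [sq_nonneg ‖Γ‖]
  have hcomb : 2 * (1 - δ) * ‖Γ‖ ^ 2 ≤ 3 * δ * ‖X‖ * ‖Y‖ * ‖Γ‖ := by
    have := le_abs_self (OpensChart.koszulForm G x Y X Z)
    linarith
  by_cases hΓ0 : Γ = 0
  · rw [hΓ0, norm_zero]; positivity
  · have hpos : 0 < ‖Γ‖ := norm_pos_iff.2 hΓ0
    have h1 : 2 * (1 - δ) * ‖Γ‖ ≤ 3 * δ * ‖X‖ * ‖Y‖ := by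
      rw [pow_two, ← mul_assoc] at hcomb
      exact le_of_mul_le_mul_right hcomb hpos
    nlinarith [mul_nonneg hδ0 (mul_nonneg (norm_nonneg X) (norm_nonneg Y))]

/-! ### The components of a pulled-back spacetime metric in a flat chart -/

section Components

variable (𝓢 : Spacetime 4) {U : TopologicalSpace.Opens E4} {Φ : U → 𝓢.carrier}

/-- **The metric components `G = η + e` of a flat chart are smooth.** For a smooth chart map
`Φ : U → 𝓢.carrier`, `U : Opens E4`, the function `x ↦ η + e(x)`, `e = deviationExtend` (the
deviation `Φ^* g - η` extended by zero), agrees on `U` with the pullback `Φ^* g` and is `C^∞` at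
every point of `U` (smoothness of the pulled-back section, `contMDiff_pullbackBilin_holds`, read in
the identity trivialisation of the bilinear-form bundle of `U`, `contMDiffAt_bilinSection_iff`). -/
theorem contDiffAt_components (hΦ : ContMDiff 𝓘(ℝ, E4) (𝓡 4) ∞ Φ) (x : U) :
    (∀ y : U, (pullbackBilin (I := 𝓡 4) (I' := 𝓘(ℝ, E4)) Φ 𝓢.metric.val y :
        E4 →L[ℝ] E4 →L[ℝ] ℝ) =
      Minkowski.bilin + 𝓢.deviationExtend (Minkowski.backgroundOn U) Φ y) ∧
    ContDiffAt ℝ ∞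
      (fun z : E4 ↦ Minkowski.bilin + 𝓢.deviationExtend (Minkowski.backgroundOn U) Φ z) x := by
  have hBG : ∀ y : U, (pullbackBilin (I := 𝓡 4) (I' := 𝓘(ℝ, E4)) Φ 𝓢.metric.val y :
      E4 →L[ℝ] E4 →L[ℝ] ℝ) =
      Minkowski.bilin + 𝓢.deviationExtend (Minkowski.backgroundOn U) Φ y := by
    intro y
    rw [Spacetime.deviationExtend_coe]
    exact (add_sub_cancel _ _).symm
  refine ⟨hBG, ?_⟩
  have hsec := PseudoRiemannianMetric.contMDiff_pullbackBilin_holds (I := 𝓡 4)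
    (M := 𝓢.carrier) (I' := 𝓘(ℝ, E4)) (N := U) (n := ∞) Φ (hΦ.of_le (le_of_eq (by rfl)))
    𝓢.metric.toPseudoRiemannianMetric
  exact (OpensChart.contMDiffAt_bilinSection_iff x _ _ hBG).1 (hsec x)

/-- **Pointwise `C¹` bounds from the slab deviation.** If the `C¹` deviation of the chart on the
flat slab through `x ∈ U` is at most `δ` (`deviationCk … 1 (x⁰) ≤ δ`), then `‖e(x)‖ ≤ δ` and
`‖De(x)‖ ≤ δ` for `e = deviationExtend` (`enorm_iteratedFDeriv_le_supCkENorm` with `m = 0, 1`). -/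
theorem deviation_bounds (Ψ : U → 𝓢.carrier) {δ : ℝ} (hδ : 0 ≤ δ) {x : E4} (hx : x ∈ U)
    (hdev : 𝓢.deviationCk (Minkowski.backgroundOn U) Ψ 1 (x 0) ≤ ENNReal.ofReal δ) :
    ‖𝓢.deviationExtend (Minkowski.backgroundOn U) Ψ x‖ ≤ δ ∧
    ‖fderiv ℝ (𝓢.deviationExtend (Minkowski.backgroundOn U) Ψ) x‖ ≤ δ := by
  have hmem : x ∈ Subtype.val '' (Minkowski.backgroundOn U).timeSlab (x 0) :=
    ⟨⟨x, hx⟩, rfl, rfl⟩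
  unfold Spacetime.deviationCk at hdev
  have h0 := (enorm_iteratedFDeriv_le_supCkENorm (k := 1) (m := 0) zero_le_one hmem
    (𝓢.deviationExtend (Minkowski.backgroundOn U) Ψ)).trans hdev
  have h1 := (enorm_iteratedFDeriv_le_supCkENorm (k := 1) (m := 1) le_rfl hmem
    (𝓢.deviationExtend (Minkowski.backgroundOn U) Ψ)).trans hdev
  rw [← ofReal_norm, ENNReal.ofReal_le_ofReal_iff hδ] at h0 h1
  rw [norm_iteratedFDeriv_zero] at h0
  rw [← norm_iteratedFDeriv_fderiv, norm_iteratedFDeriv_zero] at h1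
  exact ⟨h0, h1⟩

/-- **`dΦ` is injective where the deviation is small**: if `‖e(x)‖ < 1` at `x ∈ U` then
`mfderiv Φ x` is injective — a vector `v` with `dΦ v = 0` is `(η + e(x))`-orthogonal to
everything, and `η + e(x)` is nondegenerate (`(1 - ‖e‖)‖v‖² ≤ (η + e)(v, θv) = 0`). -/
theorem injective_mfderiv_of_norm_deviation_lt (hΦ : ContMDiff 𝓘(ℝ, E4) (𝓡 4) ∞ Φ) (x : U)
    (hx : ‖𝓢.deviationExtend (Minkowski.backgroundOn U) Φ x‖ < 1) :
    Function.Injective (mfderiv 𝓘(ℝ, E4) (𝓡 4) Φ x) := by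
  set e := 𝓢.deviationExtend (Minkowski.backgroundOn U) Φ x with he_def
  refine (injective_iff_map_eq_zero (mfderiv 𝓘(ℝ, E4) (𝓡 4) Φ x)).2 fun (v : E4) hv ↦ ?_
  have hBG := (contDiffAt_components 𝓢 hΦ x).1 x
  have horth : ∀ w : E4, Minkowski.bilin v w + e v w = 0 := by
    intro w
    have h1 : (pullbackBilin (I := 𝓡 4) (I' := 𝓘(ℝ, E4)) Φ 𝓢.metric.val x :
        E4 →L[ℝ] E4 →L[ℝ] ℝ) v w = 0 := by
      rw [pullbackBilin_apply, hv, map_zero]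
      rfl
    rw [hBG] at h1
    exact h1
  exact eq_zero_of_forall_bilin_add_eq_zero hx horth

/-- **`dΦ` is injective where the deviation is small, registered form** (the sub-goal
`flatChart_mfderiv_injective` of crux item stmt-FinalStateConjecture-13550, line
`sojourn-needs-only-one-over-delta`): the statement of `injective_mfderiv_of_norm_deviation_lt` as
one closed proposition. -/
theorem flatChart_mfderiv_injective : ∀ (𝓢 : Spacetime 4) {U : TopologicalSpace.Opens E4} {Φ : U → 𝓢.carrier}, ContMDiff 𝓘(ℝ, E4) (𝓡 4) ∞ Φ → ∀ (x : U), ‖𝓢.deviationExtend (Minkowski.backgroundOn U) Φ x‖ < 1 → Function.Injective (mfderiv 𝓘(ℝ, E4) (𝓡 4) Φ x) :=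
  fun 𝓢 _ _ hΦ x hx ↦ injective_mfderiv_of_norm_deviation_lt 𝓢 hΦ x hx

end Components

end Summit.FinalStateConjecture.FinalStateConjecture.Theorems.StarvedNecks.OneOverDelta

end
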